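import Summits.Langlands.Langlands.Theorems.SoloInformedGLOneHodgeTateParallel
import HarnessLib

/-!
# Λ26 — Parallel type ⇒ de Rham above `ℓ` unconditionally; over a totally real field clause (A⁺)₁ is a theorem

Solo (informed) programme, rung Λ26.  Λ24 (`SoloInformedGLOneHodgeTateParallel`) computed the
labelled Hodge–Tate weights of Weil's character `r_{θ,ι}` for a Hecke character `θ` of PARALLEL
infinity type (`n_φ = n₀` for every `φ : K → ℂ`) and deduced, over a totally real `K`, clause (A⁺)₁ of
the R3⁺-repaired summit GRANTING the named fact dR₁ (`HeckeCharacter.exists_lAdic_isDeRhamFramed`: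
`r_{θ,ι}` is de Rham above `ℓ`).  The same finite-image device removes dR₁ altogether in the parallel
case: `r_{θ,ι} ⊗ ε_ℓ^{n₀}` has finite image (Weil + Frobenius rigidity,
`FramedGaloisRep.finite_range_twist_of_hasFrobCharpolyAt_of_embExponent_eq`), a finite-image local
representation is de Rham for THE pinned datum by Hilbert 90 over its splitting field
(`fontainePstAdicCompletion_isDeRhamFramed_of_finite_range`, accepted and unconditional), and de
Rham-ness is stable under Tate twists (`fontainePstAdicCompletion_isDeRhamFramed_tateTwist_of_isDeRhamFramed`).
Hence, with NO named fact and at EVERY `v ∣ ℓ` (ramified for `θ` or not):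

* §1 `isDeRhamFramed_toLocal_of_embExponent_eq`: every `ρ : Γ_K → GL₁(ℚ̄_ℓ)` with Weil's Frobenius
  dictionary for a `θ` of parallel type is de Rham at every `v ∣ ℓ` for the pinned datum; in particular
  `r_{θ,ι}` (`isDeRhamFramed_weilRep_toLocal_of_embExponent_eq`).
* §2 ★★★ `automorphicToGaloisR3plus_one_of_isTotallyReal`: over a totally real field clause (A⁺)₁ of
  the R3⁺-repaired summit HOLDS — a theorem of the tree, no hypotheses; ★★★
  `globalLanglandsCorrespondenceGLnR3plus_one_of_fact_of_isTotallyReal`: the repaired `n = 1` conjunct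
  over a totally real field holds granting FM₁ ALONE (Λ24 needed dR₁ as well).
* §3 Over an arbitrary number field: clause (A⁺)₁ ⟺ (dR ∧ HT) for the NON-parallel (CM-type) Hecke
  characters only (`automorphicToGaloisR3plus_one_iff_nonparallel`, no named fact), and granting FM₁
  the repaired conjunct ⟺ the same (`globalLanglandsCorrespondenceGLnR3plus_one_iff_nonparallel_of_fact`).

What is left of dR₁ ∧ HT₁ for `GL₁` is thereby confined to characters of non-parallel type, which
exist iff `K` contains a CM field (Weil 1956 §1; Serre III §2.3), and there — by Λ25′
(`SoloInformedGLOneHodgeTateLocallyParallel`) — to the places `v ∣ ℓ` at which `θ` is ramified or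
not `v`-locally parallel.  Plain theorems of the literature about constructed objects; no definitions.

Citations: [SerreAbelianLadic1968] Ch. III §1.1, §2.3, §3 and App. A.5; [Weil1956] §§1–2;
[Patrikis2019] Prop. 2.2.1, Cor. 2.2.3, Lemma 2.2.4; [FontaineAsterisque223III] Exp. III §1.5 and §3;
[FontaineMazurGeometric1995] §1 and Conj. 1; [BuzzardGeeLMS2014] Conj. 3.2.1–3.2.2, Rem. 3.2.3 and
Rem. 3.2.5; [Conrad2011LiftingGlobal] App. B Prop. B.4.
-/

noncomputable section
open scoped MatrixGroups Matrix Classical Polynomial NumberField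
open NumberField IsDedekindDomain Field Polynomial Filter
open Literature.NumberTheory.Automorphic Literature.NumberTheory.GaloisRepresentations
open Literature.NumberTheory.PAdicHodge

namespace Summit.Langlands.Langlands.Theorems

namespace GLOneRigidity

section TotallyReal

variable {K : Type} [Field K] [NumberField K] {hcpt : isCompact_glFiniteIntegralLevel 1 K}
  {ℓ : ℕ} [Fact ℓ.Prime] {θ : HeckeCharacter K} {p q : InfinitePlace K → ℤ}
  {T : Finset (HeightOneSpectrum (𝓞 K))} {e : HeightOneSpectrum (𝓞 K) → ℕ}

/-! ### §1 Parallel type ⇒ de Rham at every `v ∣ ℓ`, unconditionally -/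

/-- ★★ **A character with Weil's Frobenius dictionary for a Hecke character of parallel type is de Rham
at every `v ∣ ℓ` for THE pinned datum — unconditionally** (no named fact, no (PU)/(LT) input, `θ`
ramified at `v` or not).  Proof: `ρ ⊗ ε_ℓ^{n₀}` has finite image (Weil: `θ‖·‖^{n₀}` has finite
order; Frobenius rigidity), a finite-image local representation is de Rham (Hilbert 90 over the finite
Galois splitting field, `fontainePstAdicCompletion_isDeRhamFramed_of_finite_range`), and
`ρ|Γ_{K_v} = (ρ ⊗ ε_ℓ^{n₀})|Γ_{K_v} ⊗ ε_ℓ^{-n₀}` is a Tate twist of it.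
[cite: SerreAbelianLadic1968, Ch. III §1.1, §2.3 and App. A.5] [cite: Patrikis2019, Cor. 2.2.3 (proof) and Lemma 2.2.4]
[cite: FontaineAsterisque223III, Exp. III §1.5 and §3] [cite: FontaineMazurGeometric1995, §1] -/
theorem isDeRhamFramed_toLocal_of_embExponent_eq
    (ρ : FramedGaloisRep K (PadicAlgCl ℓ) 1) (ι : PadicAlgCl ℓ ≃+* ℂ) (hinf : θ.HasInfinityType p q)
    (hρ : ∀ᶠ w : HeightOneSpectrum (𝓞 K) in cofinite,
      ρ.HasFrobCharpolyAt w (X - C (ι.symm (θ.valueAtUniformizer w)⁻¹)))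
    {n₀ : ℤ} (hn : ∀ φ : K →+* ℂ, HeckeCharacter.embExponent p q φ = n₀)
    (v : HeightOneSpectrum (𝓞 K)) (hv : ((ℓ : ℕ) : 𝓞 K) ∈ v.asIdeal) :
    (fontainePstAdicCompletion v ℓ hv).IsDeRhamFramed (ρ.toLocal v) := by
  haveI : NeZero (ℓ : K) := ⟨Nat.cast_ne_zero.mpr (Fact.out : ℓ.Prime).ne_zero⟩
  -- `ε = ε_ℓ^{n₀} : Γ_K →ₜ* ℚ̄_ℓˣ`
  obtain ⟨ε, hε⟩ := exists_cyclotomicCharacter_padicAlgCl_zpow K ℓ n₀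
  -- `ρ ⊗ ε` has finite image (Weil + Frobenius rigidity), hence finite local image at `v`
  have hfin : (Set.range (FramedRep.twist ρ ε)).Finite :=
    FramedGaloisRep.finite_range_twist_of_hasFrobCharpolyAt_of_embExponent_eq ρ ι θ p q hinf hρ hn ε hε
  have hloc : (Set.range (FramedGaloisRep.toLocal v (FramedRep.twist ρ ε))).Finite := by
    refine hfin.subset ?_
    rintro _ ⟨σ, rfl⟩
    exact ⟨absGaloisRestrict K (v.adicCompletion K) σ, rfl⟩
  -- `ε⁻¹ ∘ res_v = ε_ℓ^{-n₀}` on `Γ_{K_v}`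
  have hε' : ∀ σ : absoluteGaloisGroup (v.adicCompletion K),
      ((((ε⁻¹ : absoluteGaloisGroup K →ₜ* (PadicAlgCl ℓ)ˣ).comp
          (absGaloisRestrict K (v.adicCompletion K))) σ : (PadicAlgCl ℓ)ˣ) : PadicAlgCl ℓ) =
        (algebraMap ℚ_[ℓ] (PadicAlgCl ℓ)
          ((GaloisRep.cyclotomicCharacter (v.adicCompletion K) ℓ σ : ℤ_[ℓ]ˣ) : ℤ_[ℓ])) ^ (-n₀) :=
    fun σ => by
      show (((ε (absGaloisRestrict K (v.adicCompletion K) σ))⁻¹ : (PadicAlgCl ℓ)ˣ) : PadicAlgCl ℓ) = _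
      rw [Units.val_inv_eq_inv_val, hε, cyclotomicCharacter_absGaloisRestrict K (v.adicCompletion K) ℓ σ,
        zpow_neg]
  -- `(ρ ⊗ ε)|Γ_{K_v}` is de Rham (finite image), hence so is its Tate twist by `ε⁻¹|Γ_{K_v}`
  have hdR := fontainePstAdicCompletion_isDeRhamFramed_tateTwist_of_isDeRhamFramed v hv
    (fontainePstAdicCompletion_isDeRhamFramed_of_finite_range v ℓ hv _ hloc) (-n₀)
    ((ε⁻¹ : absoluteGaloisGroup K →ₜ* (PadicAlgCl ℓ)ˣ).comp (absGaloisRestrict K (v.adicCompletion K)))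
    hε'
  -- `ρ|Γ_{K_v} = ((ρ ⊗ ε) ⊗ ε⁻¹)|Γ_{K_v} = (ρ ⊗ ε)|Γ_{K_v} ⊗ (ε⁻¹|Γ_{K_v})` (the last step definitional)
  have key : FramedRep.twist (FramedGaloisRep.toLocal v (FramedRep.twist ρ ε))
      ((ε⁻¹ : absoluteGaloisGroup K →ₜ* (PadicAlgCl ℓ)ˣ).comp (absGaloisRestrict K (v.adicCompletion K))) =
        ρ.toLocal v :=
    calc FramedRep.twist (FramedGaloisRep.toLocal v (FramedRep.twist ρ ε))
          ((ε⁻¹ : absoluteGaloisGroup K →ₜ* (PadicAlgCl ℓ)ˣ).comp (absGaloisRestrict K (v.adicCompletion K)))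
          = FramedGaloisRep.toLocal v (FramedRep.twist (FramedRep.twist ρ ε) ε⁻¹) :=
            (FramedGaloisRep.toLocal_twist v _ _).symm
      _ = ρ.toLocal v := by rw [FramedRep.twist_twist_inv]
  rw [← key]
  exact hdR

/-- ★★ **Weil's character `r_{θ,ι}` of a Hecke character of parallel type is de Rham at every `v ∣ ℓ`
for THE pinned datum — unconditionally** (§1 with Weil's dictionary
`eventually_hasFrobCharpolyAt_weilRep`; Λ24 granted the named fact dR₁ for this).  All algebraic Hecke
characters of a field containing no CM field — e.g. a totally real field — have parallel type.
[cite: SerreAbelianLadic1968, Ch. III §1.1, §2.3 and App. A.5] [cite: Weil1956, §§1–2]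
[cite: FontaineAsterisque223III, Exp. III §1.5 and §3] -/
theorem isDeRhamFramed_weilRep_toLocal_of_embExponent_eq (ι : PadicAlgCl ℓ ≃+* ℂ)
    (hinf : θ.HasInfinityType p q) (hmod : HeckeCharacter.IsModulus θ T e)
    {n₀ : ℤ} (hn : ∀ φ : K →+* ℂ, HeckeCharacter.embExponent p q φ = n₀)
    (v : HeightOneSpectrum (𝓞 K)) (hv : ((ℓ : ℕ) : 𝓞 K) ∈ v.asIdeal) :
    (fontainePstAdicCompletion v ℓ hv).IsDeRhamFramed ((hinf.weilRep hmod ι).toLocal v) :=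
  isDeRhamFramed_toLocal_of_embExponent_eq _ ι hinf (eventually_hasFrobCharpolyAt_weilRep ι hinf hmod)
    hn v hv

/-- **The same for the datum `𝓡.pst ℓ v hv` of any reciprocity datum** (which IS the pinned datum,
`ReciprocityData.pst`): the de Rham third of clause (A⁺)₁ for `θ` of parallel type, with no named fact.
[cite: BuzzardGeeLMS2014, Conj. 3.2.1 and Rem. 3.2.3] [cite: SerreAbelianLadic1968, Ch. III §2.3] -/
theorem isDeRhamFramed_pst_weilRep_toLocal_of_embExponent_eq (𝓡 : ReciprocityData K)
    (ι : PadicAlgCl ℓ ≃+* ℂ) (hinf : θ.HasInfinityType p q) (hmod : HeckeCharacter.IsModulus θ T e)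
    {n₀ : ℤ} (hn : ∀ φ : K →+* ℂ, HeckeCharacter.embExponent p q φ = n₀)
    (v : HeightOneSpectrum (𝓞 K)) (hv : ((ℓ : ℕ) : 𝓞 K) ∈ v.asIdeal) :
    (𝓡.pst ℓ v hv).IsDeRhamFramed ((hinf.weilRep hmod ι).toLocal v) :=
  isDeRhamFramed_weilRep_toLocal_of_embExponent_eq ι hinf hmod hn v hv

/-! ### §2 Over a totally real field: clause (A⁺)₁ outright, the repaired conjunct granting FM₁ alone -/

/-- ★★★ **Over a totally real field, clause (A⁺)₁ of the R3⁺-repaired summit HOLDS — no named fact,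
no hypothesis beyond the level-compactness datum `hcpt` of the statement.**  Every algebraic Hecke
character of a totally real field has parallel type (`exists_embExponent_eq_of_isTotallyReal`), so
`r_{θ,ι}` is de Rham above `ℓ` by §1 and Hodge–Tate compatible with `π` by Λ24 §2; irreducibility,
unramifiedness almost everywhere and uniqueness up to conjugacy are automatic in rank one (Λ23
`automorphicToGaloisR3plus_one_iff_weilRep`).  Λ24 `automorphicToGaloisR3plus_one_of_fact_of_isTotallyReal`
granted dR₁ for the de Rham third. [cite: BuzzardGeeLMS2014, Conj. 3.2.1 and Rem. 3.2.3]
[cite: SerreAbelianLadic1968, Ch. III §1.1, §2.3 and App. A.5] [cite: Weil1956, §1]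
[cite: FontaineAsterisque223III, Exp. III §1.5 and §3] -/
theorem automorphicToGaloisR3plus_one_of_isTotallyReal [IsTotallyReal K] (𝓡 : ReciprocityData K) :
    R3plus.AutomorphicToGaloisR3plus 1 𝓡 hcpt :=
  (automorphicToGaloisR3plus_one_iff_weilRep 𝓡).mpr fun π θ hχ p q hinf T e hmod ℓ _ ι => by
    obtain ⟨n₀, hn⟩ := exists_embExponent_eq_of_isTotallyReal hinf
    exact ⟨fun v hv => isDeRhamFramed_pst_weilRep_toLocal_of_embExponent_eq 𝓡 ι hinf hmod hn v hv,
      fun v hv => hodgeTateCompatibleAt_weilRep_of_embExponent_eq 𝓡 ι π.1 hχ hinf hmod hn v hv⟩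

/-- ★★★ **Over a totally real field the R3⁺-repaired summit HOLDS for `n = 1` granting FM₁ alone**
(`FramedGaloisRep.exists_heckeCharacter_of_isDeRhamFramed`: a character de Rham above `ℓ` has the
Frobenius dictionary of an algebraic Hecke character — Fontaine–Mazur in rank one, Patrikis
Prop. 2.2.1), for every reciprocity datum `𝓡`: clause (A⁺)₁ is the previous theorem, clause (B⁺)₁ is
FM₁ + rigidity + (A⁺)₁'s Hodge–Tate third (Λ23 `globalLanglandsCorrespondenceGLnR3plus_one_iff_weilRep`).
Λ24 `globalLanglandsCorrespondenceGLnR3plus_one_of_facts_of_isTotallyReal` needed dR₁ as well.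
[cite: BuzzardGeeLMS2014, Conj. 3.2.1–3.2.2, Rem. 3.2.3 and Rem. 3.2.5]
[cite: FontaineMazurGeometric1995, Conj. 1] [cite: Patrikis2019, Prop. 2.2.1]
[cite: SerreAbelianLadic1968, Ch. III §1.1, §2.3 and App. A.5] -/
theorem globalLanglandsCorrespondenceGLnR3plus_one_of_fact_of_isTotallyReal [IsTotallyReal K]
    (hFM : FramedGaloisRep.exists_heckeCharacter_of_isDeRhamFramed) (𝓡 : ReciprocityData K) :
    R3plus.GlobalLanglandsCorrespondenceGLnR3plus 1 K 𝓡 hcpt :=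
  (globalLanglandsCorrespondenceGLnR3plus_one_iff_weilRep 𝓡).mpr
    ⟨fun π θ hχ p q hinf T e hmod ℓ _ ι v hv => by
        obtain ⟨n₀, hn⟩ := exists_embExponent_eq_of_isTotallyReal hinf
        exact ⟨isDeRhamFramed_pst_weilRep_toLocal_of_embExponent_eq 𝓡 ι hinf hmod hn v hv,
          hodgeTateCompatibleAt_weilRep_of_embExponent_eq 𝓡 ι π.1 hχ hinf hmod hn v hv⟩,
      fun ℓ _ ι ρ hdR => exists_eq_weilRep_of_isDeRhamFramed hFM 𝓡 ι ρ hdR⟩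

/-- **Over a totally real field, granting FM₁, clause (B⁺)₁ holds as well** (the second conjunct of
the previous theorem, recorded separately). [cite: FontaineMazurGeometric1995, Conj. 1]
[cite: Patrikis2019, Prop. 2.2.1] [cite: BuzzardGeeLMS2014, Conj. 3.2.2 and Rem. 3.2.3] -/
theorem galoisToAutomorphicR3plus_one_of_fact_of_isTotallyReal [IsTotallyReal K]
    (hFM : FramedGaloisRep.exists_heckeCharacter_of_isDeRhamFramed) (𝓡 : ReciprocityData K) :
    R3plus.GaloisToAutomorphicR3plus 1 𝓡 hcpt :=
  (show R3plus.AutomorphicToGaloisR3plus 1 𝓡 hcpt ∧ R3plus.GaloisToAutomorphicR3plus 1 𝓡 hcpt from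
    globalLanglandsCorrespondenceGLnR3plus_one_of_fact_of_isTotallyReal hFM 𝓡).2

/-! ### §3 Over an arbitrary number field: only the non-parallel (CM-type) characters remain -/

/-- ★★ **Clause (A⁺)₁ over `K` ⟺ (de Rham ∧ Hodge–Tate compatible above `ℓ`) for the Weil characters
of the NON-parallel algebraic Hecke characters only — no named fact** (Λ23
`automorphicToGaloisR3plus_one_iff_weilRep` with the parallel case discharged by §1 and Λ24 §2).
Non-parallel algebraic types exist iff `K` contains a CM field.
[cite: BuzzardGeeLMS2014, Conj. 3.2.1 and Rem. 3.2.3] [cite: Weil1956, §1]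
[cite: SerreAbelianLadic1968, Ch. III §1.1, §2.3 and App. A.5] -/
theorem automorphicToGaloisR3plus_one_iff_nonparallel (𝓡 : ReciprocityData K) :
    R3plus.AutomorphicToGaloisR3plus 1 𝓡 hcpt ↔
      ∀ (π : CuspidalAutomorphicRepData 1 K hcpt) (θ : HeckeCharacter K),
        (∀ (g : (AdelicGroupData.gl 1 K).Adelic), ∀ φ ∈ π.1.W,
          rightTranslation (AdelicGroupData.gl 1 K) g φ -
            ((θ (Matrix.GeneralLinearGroup.det g) : ℂˣ) : ℂ) • φ ∈ π.1.W') →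
        ∀ (p q : InfinitePlace K → ℤ) (hinf : θ.HasInfinityType p q),
          (¬ ∃ n₀ : ℤ, ∀ φ : K →+* ℂ, HeckeCharacter.embExponent p q φ = n₀) →
          ∀ (T : Finset (HeightOneSpectrum (𝓞 K))) (e : HeightOneSpectrum (𝓞 K) → ℕ)
            (hmod : HeckeCharacter.IsModulus θ T e) (ℓ : ℕ) [Fact ℓ.Prime] (ι : PadicAlgCl ℓ ≃+* ℂ),
            (∀ (v : HeightOneSpectrum (𝓞 K)) (hv : ((ℓ : ℕ) : 𝓞 K) ∈ v.asIdeal),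
              (𝓡.pst ℓ v hv).IsDeRhamFramed ((hinf.weilRep hmod ι).toLocal v)) ∧
            ∀ (v : HeightOneSpectrum (𝓞 K)) (hv : ((ℓ : ℕ) : 𝓞 K) ∈ v.asIdeal),
              R3plus.HodgeTateCompatibleAt 𝓡 ι π.1 (hinf.weilRep hmod ι) v hv := by
  rw [automorphicToGaloisR3plus_one_iff_weilRep 𝓡]
  refine ⟨fun h π θ hχ p q hinf _ T e hmod ℓ _ ι => h π θ hχ p q hinf T e hmod ℓ ι,
    fun h π θ hχ p q hinf T e hmod ℓ _ ι => ?_⟩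
  by_cases hpar : ∃ n₀ : ℤ, ∀ φ : K →+* ℂ, HeckeCharacter.embExponent p q φ = n₀
  · obtain ⟨n₀, hn⟩ := hpar
    exact ⟨fun v hv => isDeRhamFramed_pst_weilRep_toLocal_of_embExponent_eq 𝓡 ι hinf hmod hn v hv,
      fun v hv => hodgeTateCompatibleAt_weilRep_of_embExponent_eq 𝓡 ι π.1 hχ hinf hmod hn v hv⟩
  · exact h π θ hχ p q hinf hpar T e hmod ℓ ι

/-- ★★ **Granting FM₁ alone, the R3⁺-repaired `n = 1` conjunct over `K` ⟺ (de Rham ∧ Hodge–Tate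
compatible above `ℓ`) for the Weil characters of the NON-parallel Hecke characters only** (Λ23
`globalLanglandsCorrespondenceGLnR3plus_one_iff_weilRep`; clause (B⁺)₁ from FM₁ and rigidity; the
parallel case of clause (A⁺)₁ by §1 and Λ24 §2).  Λ24
`globalLanglandsCorrespondenceGLnR3plus_one_iff_ht_nonparallel_of_facts` granted dR₁ as well and
kept only the Hodge–Tate third on the right. [cite: BuzzardGeeLMS2014, Conj. 3.2.1–3.2.2, Rem. 3.2.3 and Rem. 3.2.5]
[cite: FontaineMazurGeometric1995, Conj. 1] [cite: Patrikis2019, Prop. 2.2.1]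
[cite: SerreAbelianLadic1968, Ch. III §1.1, §2.3 and App. A.5] [cite: Weil1956, §1] -/
theorem globalLanglandsCorrespondenceGLnR3plus_one_iff_nonparallel_of_fact
    (hFM : FramedGaloisRep.exists_heckeCharacter_of_isDeRhamFramed) (𝓡 : ReciprocityData K) :
    R3plus.GlobalLanglandsCorrespondenceGLnR3plus 1 K 𝓡 hcpt ↔
      ∀ (π : CuspidalAutomorphicRepData 1 K hcpt) (θ : HeckeCharacter K),
        (∀ (g : (AdelicGroupData.gl 1 K).Adelic), ∀ φ ∈ π.1.W,
          rightTranslation (AdelicGroupData.gl 1 K) g φ -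
            ((θ (Matrix.GeneralLinearGroup.det g) : ℂˣ) : ℂ) • φ ∈ π.1.W') →
        ∀ (p q : InfinitePlace K → ℤ) (hinf : θ.HasInfinityType p q),
          (¬ ∃ n₀ : ℤ, ∀ φ : K →+* ℂ, HeckeCharacter.embExponent p q φ = n₀) →
          ∀ (T : Finset (HeightOneSpectrum (𝓞 K))) (e : HeightOneSpectrum (𝓞 K) → ℕ)
            (hmod : HeckeCharacter.IsModulus θ T e) (ℓ : ℕ) [Fact ℓ.Prime] (ι : PadicAlgCl ℓ ≃+* ℂ),
            (∀ (v : HeightOneSpectrum (𝓞 K)) (hv : ((ℓ : ℕ) : 𝓞 K) ∈ v.asIdeal),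
              (𝓡.pst ℓ v hv).IsDeRhamFramed ((hinf.weilRep hmod ι).toLocal v)) ∧
            ∀ (v : HeightOneSpectrum (𝓞 K)) (hv : ((ℓ : ℕ) : 𝓞 K) ∈ v.asIdeal),
              R3plus.HodgeTateCompatibleAt 𝓡 ι π.1 (hinf.weilRep hmod ι) v hv := by
  unfold R3plus.GlobalLanglandsCorrespondenceGLnR3plus
  rw [automorphicToGaloisR3plus_one_iff_nonparallel 𝓡]
  refine ⟨fun h => h.1, fun h => ⟨h, ?_⟩⟩
  -- clause (B⁺)₁ from FM₁, rigidity, and the Hodge–Tate third of (A⁺)₁ (parallel: Λ24; else: `h`)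
  refine (galoisToAutomorphicR3plus_one_iff_weilRep 𝓡).mpr fun ℓ _ ι ρ hdR => ?_
  obtain ⟨θ, p, q, hinf, T, e, hmod, hρ⟩ := exists_eq_weilRep_of_isDeRhamFramed hFM 𝓡 ι ρ hdR
  obtain ⟨π, hW, -⟩ := exists_cuspidal_detTwist_glOne hcpt θ
  have hχ := heckeCharacter_detTwist_glOne hW
  subst hρ
  refine ⟨θ, p, q, hinf, T, e, hmod, rfl, π, hχ, fun v hv => ?_⟩
  by_cases hpar : ∃ n₀ : ℤ, ∀ φ : K →+* ℂ, HeckeCharacter.embExponent p q φ = n₀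
  · obtain ⟨n₀, hn⟩ := hpar
    exact hodgeTateCompatibleAt_weilRep_of_embExponent_eq 𝓡 ι π.1 hχ hinf hmod hn v hv
  · exact (h π θ hχ p q hinf hpar T e hmod ℓ ι).2 v hv

end TotallyReal

end GLOneRigidity

end Summit.Langlands.Langlands.Theorems

end
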